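import Summits.ResolutionOfSingularities.ResolutionOfSingularities.Theorems.WeightedInvariantWeightedConstructionFatPointAdmissibleBound
import Literature.AlgebraicGeometry.Resolution.IdealSheafLemmas

/-!
# Fat points: the standard chart `(x₁,…,xₙ; 1,…,1; d = 2)` is admissible at the origin of `(𝔸ⁿ, 𝔪₀²)`

[OURS · L1 W4.3 · chain w43, stub worker 4] Lower bound of the chart facts for the hull-escape family
of line `pointwise-lexmax-hull`, crux `WeightedConstruction` (stmt-ResolutionOfSingularities-0571).
NOT a statement of any manuscript.

On `Y = Spec k[x₁,…,xₙ]` with `X` the ideal sheaf of `𝔪₀²` (`𝔪₀ = ker (constant coefficient)`), the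
profile `(2,…,2,⊤,…)` (`n` twos) is ADMISSIBLE at the origin (`admissibleProfileAt_fatPoint_twoProfile`):
the chart is `U = Y`, `uᵢ = xᵢ`, all weights `1`, degree `2`; the germs of the `xᵢ` lie in the maximal
ideal of `𝒪_{Y,0} = k[x]_{𝔪₀}` and their cotangent classes are linearly independent over the residue
field (`linearIndependent_toCotangent_X`: clear denominators and read the `t`-coefficient along the
coordinate line `x_l ↦ δ_{il} t`), and `𝔪₀² ≤ (x^α : |α| ≥ 2)` (`ker_constantCoeff_sq_le_weighted`).
With `admissibleProfileAt_fatPoint_le` (p468300): for every rule `R : LexmaxHullRule p` the pointwise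
value at the origin of `(𝔸ⁿ, 𝔪₀²)` is EXACTLY `(2,…,2,⊤,…)` (`LexmaxHullRule.plex_fatPoint_eq`).
-/

noncomputable section

open CategoryTheory AlgebraicGeometry
open Literature.AlgebraicGeometry.Resolution
open scoped Polynomial

set_option linter.dupNamespace false -- mandated namespace of this single-conjunct summit

namespace Summit.ResolutionOfSingularities.ResolutionOfSingularities.Theorems.PointwiseLexmaxHull

section Algebra

variable {n : ℕ} {k : Type} [Field k]

/-- `𝔪₀ = ker (constant coefficient)` is contained in (indeed equals) the ideal of the variables.
[OURS · folklore] -/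
theorem ker_constantCoeff_le_span_X :
    RingHom.ker (MvPolynomial.constantCoeff : MvPolynomial (Fin n) k →+* k) ≤
      Ideal.span (Set.range (MvPolynomial.X : Fin n → MvPolynomial (Fin n) k)) := by
  intro p hp
  rw [RingHom.mem_ker] at hp
  rw [← Set.image_univ, MvPolynomial.mem_ideal_span_X_image]
  intro m hm
  by_contra hcon
  push Not at hcon
  have hm0 : m = 0 := by
    ext i
    simpa using hcon i (Set.mem_univ i)
  subst hm0
  rw [MvPolynomial.mem_support_iff] at hm
  exact hm (by simpa [MvPolynomial.constantCoeff_eq] using hp)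

/-- `𝔪₀² ≤ (x^α : Σ αᵢ ≥ 2)`: the square of the origin's maximal ideal lies in the degree-`2` piece of
the standard chart with unit weights. [OURS · folklore] -/
theorem ker_constantCoeff_sq_le_weighted :
    RingHom.ker (MvPolynomial.constantCoeff : MvPolynomial (Fin n) k →+* k) ^ 2 ≤
      weightedMonomialIdeal (MvPolynomial.X : Fin n → MvPolynomial (Fin n) k) (fun _ => 1) 2 := by
  classical
  refine (Ideal.pow_right_mono ker_constantCoeff_le_span_X 2).trans ?_
  rw [pow_two, Ideal.span_mul_span', Ideal.span_le]
  rintro x ⟨a, ⟨i, rfl⟩, b, ⟨j, rfl⟩, rfl⟩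
  refine Ideal.subset_span ⟨Pi.single i 1 + Pi.single j 1, ?_, ?_⟩
  · simp [Finset.sum_add_distrib, Pi.single_apply]
  · simp only [Pi.add_apply, pow_add, Finset.prod_mul_distrib]
    rw [Finset.prod_eq_single i (fun l _ hl => by simp [hl])
        (fun h => absurd (Finset.mem_univ i) h),
      Finset.prod_eq_single j (fun l _ hl => by simp [hl])
        (fun h => absurd (Finset.mem_univ j) h)]
    simp

/-- Along a line, the square of `𝔪₀` restricts into `(t²)`. [OURS · folklore] -/
theorem X_sq_dvd_lineMap_of_mem_sq (c : Fin n → k) (φ : MvPolynomial (Fin n) k →ₐ[k] k[X])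
    (hφ : ∀ l, φ (MvPolynomial.X l) = Polynomial.C (c l) * Polynomial.X)
    {f : MvPolynomial (Fin n) k}
    (hf : f ∈ RingHom.ker (MvPolynomial.constantCoeff : MvPolynomial (Fin n) k →+* k) ^ 2) :
    Polynomial.X ^ 2 ∣ φ f := by
  have hle : (RingHom.ker (MvPolynomial.constantCoeff : MvPolynomial (Fin n) k →+* k)).map
      φ.toRingHom ≤ Ideal.span {(Polynomial.X : k[X])} := by
    rw [Ideal.map_le_iff_le_comap]
    intro g hg
    rw [Ideal.mem_comap, Ideal.mem_span_singleton]
    exact X_dvd_lineMap c φ hφ (RingHom.mem_ker.mp hg)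
  have hmem : φ f ∈ ((RingHom.ker (MvPolynomial.constantCoeff : MvPolynomial (Fin n) k →+* k)).map
      φ.toRingHom) ^ 2 := by
    rw [← Ideal.map_pow]
    exact Ideal.mem_map_of_mem _ hf
  have := Ideal.pow_right_mono hle 2 hmem
  rwa [Ideal.span_singleton_pow, Ideal.mem_span_singleton] at this

/-- **Cotangent independence of the coordinates.** In a localisation `L` of `k[x₁,…,xₙ]` at the origin,
the classes of `x₁,…,xₙ` in `𝔪_L/𝔪_L²` are linearly independent over the residue field.
[OURS · folklore] -/
theorem linearIndependent_toCotangent_X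
    {L : Type} [CommRing L] [IsLocalRing L] [Algebra (MvPolynomial (Fin n) k) L]
    [(RingHom.ker (MvPolynomial.constantCoeff : MvPolynomial (Fin n) k →+* k)).IsPrime]
    [IsLocalization.AtPrime L
      (RingHom.ker (MvPolynomial.constantCoeff : MvPolynomial (Fin n) k →+* k))]
    (h : ∀ i, algebraMap (MvPolynomial (Fin n) k) L (MvPolynomial.X i) ∈ IsLocalRing.maximalIdeal L) :
    LinearIndependent (IsLocalRing.ResidueField L)
      (fun i => (IsLocalRing.maximalIdeal L).toCotangent ⟨_, h i⟩) := by
  classical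
  set A := MvPolynomial (Fin n) k with hA
  set 𝔪 : Ideal A := RingHom.ker (MvPolynomial.constantCoeff : MvPolynomial (Fin n) k →+* k)
    with h𝔪
  rw [Fintype.linearIndependent_iff]
  intro g hg i₀
  -- lift the coefficients to `L`
  have hlift := fun i => Ideal.Quotient.mk_surjective (g i)
  choose c hc using hlift
  have hsum : (IsLocalRing.maximalIdeal L).toCotangent
      (∑ i, c i • (⟨_, h i⟩ : IsLocalRing.maximalIdeal L)) = 0 := by
    rw [map_sum]
    rw [← hg]
    refine Finset.sum_congr rfl fun i _ => ?_
    rw [LinearMap.map_smul, ← hc i]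
    exact (algebraMap_smul (IsLocalRing.ResidueField L) (c i) _).symm
  rw [Ideal.toCotangent_eq_zero] at hsum
  have hcoe : ((∑ i, c i • (⟨_, h i⟩ : IsLocalRing.maximalIdeal L) : IsLocalRing.maximalIdeal L) : L)
      = ∑ i, c i * algebraMap A L (MvPolynomial.X i) := by
    simp only [AddSubmonoidClass.coe_finsetSum, Submodule.coe_smul_of_tower, smul_eq_mul]
    rfl
  rw [hcoe, ← IsLocalization.AtPrime.map_eq_maximalIdeal 𝔪 L, ← Ideal.map_pow] at hsum
  -- numerators and denominators of the coefficients
  have hsurj := fun i => IsLocalization.surj 𝔪.primeCompl (c i)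
  choose qs hqs using hsurj
  set q : Fin n → A := fun i => (qs i).1 with hq
  set s : Fin n → 𝔪.primeCompl := fun i => (qs i).2 with hs
  have hqs' : ∀ i, c i * algebraMap A L (s i) = algebraMap A L (q i) := fun i => hqs i
  -- clear denominators: `S · Σ cᵢ xᵢ = Q` with `Q = Σ qᵢ xᵢ Sᵢ`
  set S : Fin n → A := fun i => ∏ l ∈ Finset.univ.erase i, (s l : A) with hS
  have hSmem : ∀ i, S i ∈ 𝔪.primeCompl := fun i => prod_mem fun l _ => (s l).2
  set Q : A := ∑ i, q i * MvPolynomial.X i * S i with hQ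
  have hQ' : algebraMap A L (∏ l, (s l : A)) * ∑ i, c i * algebraMap A L (MvPolynomial.X i) =
      algebraMap A L Q := by
    rw [hQ, map_sum, Finset.mul_sum]
    refine Finset.sum_congr rfl fun i _ => ?_
    rw [← Finset.prod_erase_mul _ _ (Finset.mem_univ i), map_mul, map_mul, map_mul, ← hqs' i]
    change algebraMap A L (S i) * _ * _ = _
    ring
  have hQmem : algebraMap A L Q ∈ (𝔪 ^ 2).map (algebraMap A L) := by
    rw [← hQ']
    exact Ideal.mul_mem_left _ _ hsum
  obtain ⟨⟨⟨a, ha⟩, t⟩, hat⟩ := (IsLocalization.mem_map_algebraMap_iff 𝔪.primeCompl L).mp hQmem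
  simp only at hat
  rw [← map_mul] at hat
  obtain ⟨e, he⟩ := (IsLocalization.eq_iff_exists 𝔪.primeCompl L).mp hat
  have hT𝔪 : ((e : A) * (t : A)) ∉ 𝔪 := by
    intro hmem
    rcases (inferInstance : 𝔪.IsPrime).mem_or_mem hmem with h' | h'
    · exact e.2 h'
    · exact t.2 h'
  have hTQ : (e : A) * (t : A) * Q ∈ 𝔪 ^ 2 := by
    have heq : (e : A) * (t : A) * Q = (e : A) * a := by rw [mul_assoc, mul_comm (t : A), he]
    rw [heq]
    exact Ideal.mul_mem_left _ _ ha
  -- restrict to the coordinate line of `i₀`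
  set φ : A →ₐ[k] k[X] :=
    MvPolynomial.aeval fun l => Polynomial.C (Pi.single (M := fun _ => k) i₀ 1 l) * Polynomial.X
    with hφdef
  have hφ : ∀ l, φ (MvPolynomial.X l) = Polynomial.C (Pi.single (M := fun _ => k) i₀ 1 l) *
      Polynomial.X := fun l => MvPolynomial.aeval_X _ l
  have hφQ : φ Q = φ (q i₀) * φ (S i₀) * Polynomial.X := by
    rw [hQ, map_sum, Finset.sum_eq_single i₀]
    · rw [map_mul, map_mul, hφ]; simp; ring
    · intro j _ hj
      rw [map_mul, map_mul, hφ]; simp [hj]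
    · intro h'; exact absurd (Finset.mem_univ i₀) h'
  have hdvd : Polynomial.X ^ 2 ∣ φ ((e : A) * (t : A) * Q) :=
    X_sq_dvd_lineMap_of_mem_sq _ φ hφ hTQ
  have hcoeff1 : (φ ((e : A) * (t : A) * Q)).coeff 1 =
      MvPolynomial.constantCoeff ((e : A) * (t : A)) * MvPolynomial.constantCoeff (q i₀) *
        MvPolynomial.constantCoeff (S i₀) := by
    rw [map_mul, hφQ, ← mul_assoc, ← mul_assoc, Polynomial.coeff_mul_X, Polynomial.mul_coeff_zero,
      Polynomial.mul_coeff_zero, coeff_zero_lineMap _ φ hφ, coeff_zero_lineMap _ φ hφ,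
      coeff_zero_lineMap _ φ hφ]
  have hzero : (φ ((e : A) * (t : A) * Q)).coeff 1 = 0 := (Polynomial.X_pow_dvd_iff.mp hdvd) 1 one_lt_two
  rw [hcoeff1] at hzero
  -- hence `q i₀ ∈ 𝔪₀`, so `c i₀ ∈ 𝔪_L` and `g i₀ = 0`
  have hq𝔪 : q i₀ ∈ 𝔪 := by
    rcases mul_eq_zero.mp hzero with h0 | h0
    · rcases mul_eq_zero.mp h0 with h1 | h1
      · exact absurd (RingHom.mem_ker.mpr h1) hT𝔪
      · exact RingHom.mem_ker.mpr h1
    · exact absurd (RingHom.mem_ker.mpr h0) (hSmem i₀)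
  have hc𝔪 : c i₀ ∈ IsLocalRing.maximalIdeal L := by
    have hmem : c i₀ * algebraMap A L (s i₀) ∈ IsLocalRing.maximalIdeal L := by
      rw [hqs' i₀]
      exact (IsLocalization.AtPrime.to_map_mem_maximal_iff L 𝔪 (q i₀)).mpr hq𝔪
    exact (Ideal.mul_unit_mem_iff_mem _ (IsLocalization.map_units L (s i₀))).mp hmem
  rw [← hc i₀]
  exact Ideal.Quotient.eq_zero_iff_mem.mpr hc𝔪

end Algebra

/-- **The standard chart is admissible at the origin of `(𝔸ⁿ, 𝔪₀²)`**: on `Spec k[x₁,…,xₙ]` with `X`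
the ideal sheaf of `𝔪₀²`, the profile `(2,…,2,⊤,…)` (`n` twos) is admissible at the origin — chart
`U = Y`, `uᵢ = xᵢ`, weights `1`, degree `2`. [OURS · folklore] -/
theorem admissibleProfileAt_fatPoint_twoProfile (n : ℕ) (k : Type) [Field k] :
    AdmissibleProfileAt
      (Scheme.IdealSheafData.ofIdealTop
        (((RingHom.ker (MvPolynomial.constantCoeff : MvPolynomial (Fin n) k →+* k)) ^ 2).map
          (Scheme.ΓSpecIso (.of (MvPolynomial (Fin n) k))).inv.hom))
      (⟨RingHom.ker (MvPolynomial.constantCoeff : MvPolynomial (Fin n) k →+* k),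
        RingHom.ker_isPrime _⟩ : Spec (.of (MvPolynomial (Fin n) k)))
      (chartProfile (m := n) 2 (fun _ => 1)) := by
  set A := MvPolynomial (Fin n) k with hA
  haveI h𝔪 : (RingHom.ker (MvPolynomial.constantCoeff : MvPolynomial (Fin n) k →+* k)).IsPrime :=
    RingHom.ker_isPrime _
  set 𝔪 : Ideal A := RingHom.ker (MvPolynomial.constantCoeff : MvPolynomial (Fin n) k →+* k)
    with h𝔪def
  set y₀ : Spec (.of A) := ⟨𝔪, h𝔪⟩ with hy₀
  letI : Algebra A ((Spec (.of A)).presheaf.stalk y₀) := StructureSheaf.stalkAlgebra A y₀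
  haveI : IsLocalization.AtPrime ((Spec (.of A)).presheaf.stalk y₀) y₀.asIdeal :=
    StructureSheaf.IsLocalization.to_stalk A y₀
  have hgerm : ∀ a : A, ((Spec (.of A)).presheaf.germ ⊤ y₀ trivial).hom
      ((Scheme.ΓSpecIso (.of A)).inv.hom a) = algebraMap A ((Spec (.of A)).presheaf.stalk y₀) a :=
    fun a => rfl
  have hX : ∀ i, algebraMap A ((Spec (.of A)).presheaf.stalk y₀) (MvPolynomial.X i) ∈
      IsLocalRing.maximalIdeal _ :=
    fun i => (IsLocalization.AtPrime.to_map_mem_maximal_iff _ 𝔪 (MvPolynomial.X i)).mpr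
      (RingHom.mem_ker.mpr (MvPolynomial.constantCoeff_X (R := k) i))
  have hX' : ∀ i, ((Spec (.of A)).presheaf.germ ⊤ y₀ trivial).hom
      ((Scheme.ΓSpecIso (.of A)).inv.hom (MvPolynomial.X i)) ∈ IsLocalRing.maximalIdeal _ :=
    fun i => by rw [hgerm]; exact hX i
  refine ⟨⟨⊤, isAffineOpen_top _⟩, trivial, n,
    fun i => (Scheme.ΓSpecIso (.of A)).inv.hom (MvPolynomial.X i), fun _ => 1, 2,
    fun _ => one_pos, fun _ _ _ => le_rfl, two_pos, ⟨hX', ?_⟩, ?_, rfl⟩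
  · -- cotangent independence
    exact linearIndependent_toCotangent_X (n := n) (k := k)
      (L := (Spec (.of A)).presheaf.stalk y₀) hX
  · -- `X(Y) = 𝔪₀² ≤ (x^α : |α| ≥ 2)`
    change (Scheme.IdealSheafData.ofIdealTop ((𝔪 ^ 2).map (Scheme.ΓSpecIso (.of A)).inv.hom)).ideal
        ⟨⊤, isAffineOpen_top _⟩ ≤ _
    rw [ideal_ofIdealTop_top, ← weightedMonomialIdeal_map]
    exact Ideal.map_mono ker_constantCoeff_sq_le_weighted

/-- **The pointwise value at a fat point.** For every rule `R : LexmaxHullRule p` and every perfect field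
`k` of characteristic `p` (structure map of `𝔸ⁿ_k` smooth, separated, quasi-compact), at the origin
of `(Spec k[x₁,…,xₙ], 𝔪₀²)` (closed and singular) the pointwise value is EXACTLY `(2,…,2,⊤,…)`
(`n` twos). [OURS · folklore] -/
theorem LexmaxHullRule.plex_fatPoint_eq {p : ℕ} (R : LexmaxHullRule p) (n : ℕ) (k : Type) [Field k]
    [CharP k p] [PerfectField k]
    [Smooth (Spec.map (CommRingCat.ofHom (algebraMap k (MvPolynomial (Fin n) k))))]
    [IsSeparated (Spec.map (CommRingCat.ofHom (algebraMap k (MvPolynomial (Fin n) k))))]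
    [QuasiCompact (Spec.map (CommRingCat.ofHom (algebraMap k (MvPolynomial (Fin n) k))))]
    (hclosed : IsClosed ({(⟨RingHom.ker (MvPolynomial.constantCoeff : MvPolynomial (Fin n) k →+* k),
        RingHom.ker_isPrime _⟩ : Spec (.of (MvPolynomial (Fin n) k)))} :
        Set (Spec (.of (MvPolynomial (Fin n) k)))))
    (hsing : XSing
      (Scheme.IdealSheafData.ofIdealTop
        (((RingHom.ker (MvPolynomial.constantCoeff : MvPolynomial (Fin n) k →+* k)) ^ 2).map
          (Scheme.ΓSpecIso (.of (MvPolynomial (Fin n) k))).inv.hom))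
      (⟨RingHom.ker (MvPolynomial.constantCoeff : MvPolynomial (Fin n) k →+* k),
        RingHom.ker_isPrime _⟩ : Spec (.of (MvPolynomial (Fin n) k)))) :
    R.plex (Spec.map (CommRingCat.ofHom (algebraMap k (MvPolynomial (Fin n) k))))
      (Scheme.IdealSheafData.ofIdealTop
        (((RingHom.ker (MvPolynomial.constantCoeff : MvPolynomial (Fin n) k →+* k)) ^ 2).map
          (Scheme.ΓSpecIso (.of (MvPolynomial (Fin n) k))).inv.hom))
      ⟨RingHom.ker (MvPolynomial.constantCoeff : MvPolynomial (Fin n) k →+* k),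
        RingHom.ker_isPrime _⟩ = chartProfile (m := n) 2 (fun _ => 1) :=
  le_antisymm (R.plex_fatPoint_le n k hclosed hsing)
    ((R.plex_isGreatest _ _ _ hclosed hsing).2 (admissibleProfileAt_fatPoint_twoProfile n k))

end Summit.ResolutionOfSingularities.ResolutionOfSingularities.Theorems.PointwiseLexmaxHull

end
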